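import Mathlib
import HarnessLib
import Literature.MathematicalPhysics.QuantumLattice.GaugeGroups
import Literature.MathematicalPhysics.QuantumFieldTheory.ConstructiveQFTWave0
import Literature.MathematicalPhysics.QuantumFieldTheory.U1GinibreComparison
import Summits.Ventures.LatticeQCDFlow.Scaling.Conjectures
import Summits.Ventures.LatticeQCDFlow.Scaling.ConjecturesRepaired
import Summits.Ventures.LatticeQCDFlow.Scaling.LatticeEntropy
import Summits.Ventures.LatticeQCDFlow.Scaling.LatticeGibbs
import Summits.Ventures.LatticeQCDFlow.Scaling.ExactTransportVolume
import Summits.Ventures.LatticeQCDFlow.Scaling.CircleBallVolume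
import Summits.Ventures.LatticeQCDFlow.Scaling.ExtensiveActionInstances

/-!
# LatticeQCDFlow / Scaling — (C2a-R) from ball volumes and an extensive configuration at `L ≥ 2`; the instance `U(1)`

HONEST FRAMING: exact (Metropolis-corrected) sampling algorithms for lattice gauge theory; figures of merit are
autocorrelation/cost numbers at stated couplings and volumes; no continuum-physics claim.

Venture `LatticeQCDFlow` (cell pub-lqcd), topic `Scaling`, FANOUT row 30 (lean-1) — OUR WORK (theory2's 11:15Z
request).  `exactTransportBiLipschitzR_of_ballVolumes` is `exactTransportBiLipschitz_of_ballVolumes`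
(`Scaling/ExactTransportVolume.lean`) with the extensive-configuration hypothesis (S) asked only for `L ≥ 2` and the
conclusion the REPAIRED item `Conjectures.ExactTransportBiLipschitzR d N G ρ` (`Scaling/ConjecturesRepaired.lean`, whose
conclusion quantifies `∀ L, 2 ≤ L →`); the proof is the same density-ratio / ball-volume argument, verbatim.  With
theory2's `U1.extensive_action_R` (staircase configuration, `Scaling/ExtensiveActionInstances.lean`) and the two-sided
chordal-ball volumes `U1.haar_closedBall_ge'/le'` (`Scaling/CircleBallVolume.lean`, `κ = 1`) this gives
**`U1.exactTransportBiLipschitzR d (hd : 2 ≤ d) : Conjectures.ExactTransportBiLipschitzR d 1 Circle u1Rep`** — (C2a-R)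
for `U(1)`, the case where the unrepaired item is false at `L = 1` (`Scaling/ExactTransportDegenerate.lean`).  Together
with `SUN/UN.exactTransportBiLipschitzR` (N ≥ 2; theory2 items 34b/34c over row 30's theorems) (C2a-R) is settled for
every gauge group of the venture.  Elementary; nothing is cited as a fact.
-/

noncomputable section

namespace Summit.Ventures.LatticeQCDFlow.Theory2.Lattice

open MeasureTheory Metric Set Literature.MathematicalPhysics.QuantumFieldTheory

section ExactTransportR

variable {N : ℕ} {G : Type} [Group G] [MetricSpace G] [IsTopologicalGroup G] [CompactSpace G]
  [SecondCountableTopology G] [MeasurableSpace G] [BorelSpace G]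
  (ρ : G →* Matrix (Fin N) (Fin N) ℂ)

/-- **(C2a-R) FROM BALL VOLUMES AND AN EXTENSIVE CONFIGURATION AT EVERY `L ≥ 2`** (OURS): as
`exactTransportBiLipschitz_of_ballVolumes`, with (S) only for `L ≥ 2`, concluding the repaired item; `c = s₀/(8κd)`,
`β₀ = 16d·log(A/a)/s₀`. [folklore] -/
theorem exactTransportBiLipschitzR_of_ballVolumes (d : ℕ) (hd : 1 ≤ d)
    (hρ : Continuous (ρ : G → Matrix (Fin N) (Fin N) ℂ))
    (htr : ∀ g, (ρ g).trace.re ≤ N) (htr' : ∀ g, -(N : ℝ) ≤ (ρ g).trace.re)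
    {κ : ℕ} (hκ : 0 < κ) {a A : ℝ} (ha : 0 < a)
    (hlo : ∀ (g : G) (r : ℝ), 0 < r → r ≤ 1 → a * r ^ κ ≤ (haarProbability G (closedBall g r)).toReal)
    (hup : ∀ (g : G) (r : ℝ), 0 < r → (haarProbability G (closedBall g r)).toReal ≤ A * r ^ κ)
    {s₀ : ℝ} (hs₀ : 0 < s₀)
    (hconf : ∀ (L : ℕ) [NeZero L], 2 ≤ L → ∃ V : GaugeConfig d L G, s₀ * (L : ℝ) ^ d ≤ wilsonAction ρ V) :
    Conjectures.ExactTransportBiLipschitzR d N G ρ := by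
  intro _ _ _
  have haA : a ≤ A := by
    have h1 := hlo 1 1 one_pos le_rfl
    have h2 := hup 1 1 one_pos
    rw [one_pow, mul_one] at h1 h2
    exact h1.trans h2
  have hA : 0 < A := ha.trans_le haA
  have hlogAa : 0 ≤ Real.log (A / a) := Real.log_nonneg ((one_le_div ha).2 haA)
  refine ⟨s₀ / (8 * κ * d), by positivity, 16 * d * Real.log (A / a) / s₀,
    fun L _ hL2 β hβ T K K' hT hT' hmap => ?_⟩
  have hβ0 : 0 ≤ β := le_trans (by positivity) hβ
  have hκr : (0 : ℝ) < κ := by exact_mod_cast hκ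
  have hdr : (1 : ℝ) ≤ d := by exact_mod_cast hd
  have hL1 : (1 : ℝ) ≤ L := by exact_mod_cast (NeZero.one_le : 1 ≤ L)
  have hLd : (1 : ℝ) ≤ (L : ℝ) ^ d := one_le_pow₀ hL1
  set π : Measure (GaugeConfig d L G) := Measure.pi fun _ : Edge d L => haarProbability G with hπ
  set S : GaugeConfig d L G → ℝ := wilsonAction (d := d) (L := L) ρ with hSdef
  have hScont : Continuous S := continuous_wilsonAction (d := d) (L := L) ρ hρ
  have hTm : Measurable T := hT.continuous.measurable
  -- cardinalities
  have hEn : Fintype.card (Edge d L) = L ^ d * d := by simp [Fintype.card_prod, ZMod.card, Fintype.card_fin]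
  have hE : (Fintype.card (Edge d L) : ℝ) = d * (L : ℝ) ^ d := by rw [hEn]; push_cast; ring
  set nE : ℕ := Fintype.card (Edge d L) with hnE
  have hnE0 : (0 : ℝ) < nE := by rw [hnE, hE]; positivity
  -- the partition function
  have hZ0 : partitionFunction (d := d) (L := L) ρ β ≠ 0 := partitionFunction_ne_zero ρ hρ β
  have hZtop : partitionFunction (d := d) (L := L) ρ β ≠ ⊤ :=
    ne_top_of_le_ne_top ENNReal.one_ne_top (partitionFunction_le_one ρ htr hβ0)
  set Z : ℝ := (partitionFunction (d := d) (L := L) ρ β).toReal with hZdef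
  have hZpos : 0 < Z := ENNReal.toReal_pos hZ0 hZtop
  -- two distinct configurations: the identity and a high-action one
  obtain ⟨Vhi, hVhi⟩ := hconf L hL2
  set V₁ : GaugeConfig d L G := fun _ => 1 with hV₁
  have hS1 : S V₁ = 0 := by
    simp only [hSdef, hV₁, wilsonAction, plaquetteHolonomy, mul_one, inv_one, map_one, Matrix.trace_one,
      Fintype.card_fin]
    simp
  have hs₀L : 0 < s₀ * (L : ℝ) ^ d := by positivity
  have hne : Vhi ≠ V₁ := by
    intro h; rw [h] at hVhi; rw [← hSdef, hS1] at hVhi; linarith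
  -- `1 ≤ K·K'`, hence `K, K' > 0`
  have hKK : (1 : ℝ) ≤ K * K' := by
    have h1 : dist Vhi V₁ ≤ K' * dist (T Vhi) (T V₁) := hT'.le_mul_dist Vhi V₁
    have h2 : dist (T Vhi) (T V₁) ≤ K * dist Vhi V₁ := hT.dist_le_mul Vhi V₁
    have hpos : 0 < dist Vhi V₁ := dist_pos.2 hne
    have h3 : dist Vhi V₁ ≤ K' * K * dist Vhi V₁ := by
      calc _ ≤ K' * dist (T Vhi) (T V₁) := h1
        _ ≤ K' * (K * dist Vhi V₁) := mul_le_mul_of_nonneg_left h2 K'.coe_nonneg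
        _ = _ := by ring
    nlinarith
  have hK0 : (0 : ℝ) < K := by
    rcases K.coe_nonneg.eq_or_lt with h | h
    · rw [← h, zero_mul] at hKK; linarith
    · exact h
  have hK'0 : (0 : ℝ) < K' := by
    rcases K'.coe_nonneg.eq_or_lt with h | h
    · rw [← h, mul_zero] at hKK; linarith
    · exact h
  -- μ of a measurable set as the prior mass of its preimage
  have hμT : ∀ B : Set (GaugeConfig d L G), MeasurableSet B →
      wilsonMeasure (d := d) (L := L) ρ β B = π (T ⁻¹' B) := fun B hB => by
    rw [← hmap, Measure.map_apply hTm hB]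
  have hμW : ∀ B : Set (GaugeConfig d L G),
      wilsonMeasure (d := d) (L := L) ρ β B = (partitionFunction ρ β)⁻¹ * wilsonWeight ρ β B := fun B => by
    show ((partitionFunction ρ β)⁻¹ • wilsonWeight ρ β) B = _
    rw [Measure.smul_apply, smul_eq_mul]
  -- STEP 1: `log Z + β S(Tx) ≤ nE (log(A/a) + κ log K)`
  have step1 : ∀ x, Real.log Z + β * S (T x) ≤ nE * (Real.log (A / a) + κ * Real.log K) := by
    intro x
    refine le_of_forall_pos_le_add fun ε hε => ?_
    have hε' : 0 < ε / (β + 1) := by positivity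
    have hβε : β * (ε / (β + 1)) ≤ ε := by
      rw [mul_div_assoc', div_le_iff₀ (by positivity)]; nlinarith
    obtain ⟨δ, hδ, hδS⟩ := Metric.continuous_iff.1 hScont (T x) (ε / (β + 1)) hε'
    set r : ℝ := min 1 (δ / (2 * K)) with hr
    have hr0 : 0 < r := lt_min one_pos (by positivity)
    have hr1 : r ≤ 1 := min_le_left _ _
    have hKr : K * r < δ := by
      have : r ≤ δ / (2 * K) := min_le_right _ _
      calc (K : ℝ) * r ≤ K * (δ / (2 * K)) := mul_le_mul_of_nonneg_left this hK0.le
        _ = δ / 2 := by field_simp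
        _ < δ := by linarith
    -- (i) lower volume of `B̄(x, r)`
    have h1 := pow_le_pi_closedBall ha.le hlo x hr0 hr1
    -- (ii) `π(B̄(x,r)) ≤ μ(B̄(Tx, K r))`
    have hsub : closedBall x r ⊆ T ⁻¹' closedBall (T x) (K * r) := fun u hu => by
      rw [mem_preimage, mem_closedBall]
      exact (hT.dist_le_mul u x).trans (mul_le_mul_of_nonneg_left (mem_closedBall.1 hu) K.coe_nonneg)
    have h2 : π (closedBall x r) ≤ wilsonMeasure (d := d) (L := L) ρ β (closedBall (T x) (K * r)) := by
      rw [hμT _ measurableSet_closedBall]; exact measure_mono hsub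
    -- (iii) `μ(B̄(Tx, Kr)) ≤ Z⁻¹ e^{-β(S(Tx) - ε)} (A (Kr)^κ)^{nE}`
    have hSB : ∀ U ∈ closedBall (T x) (K * r), S (T x) - ε / (β + 1) ≤ S U := fun U hU => by
      have hd : dist U (T x) < δ := lt_of_le_of_lt (mem_closedBall.1 hU) hKr
      have := hδS U hd
      rw [Real.dist_eq] at this
      linarith [(abs_lt.1 this).1]
    have h3 := wilsonWeight_le_of_le ρ hβ0 measurableSet_closedBall hSB
    have h4 := pi_closedBall_le_pow hup (T x) (mul_pos hK0 hr0)
    -- assemble in `ℝ`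
    have hfin : (partitionFunction (d := d) (L := L) ρ β)⁻¹ *
        (ENNReal.ofReal (Real.exp (-(β * (S (T x) - ε / (β + 1))))) * π (closedBall (T x) (K * r))) ≠ ⊤ :=
      ENNReal.mul_ne_top (ENNReal.inv_ne_top.2 hZ0) (ENNReal.mul_ne_top ENNReal.ofReal_ne_top (measure_ne_top _ _))
    have hchain : (π (closedBall x r)).toReal ≤
        Z⁻¹ * (Real.exp (-(β * (S (T x) - ε / (β + 1)))) * (A * (K * r) ^ κ) ^ nE) := by
      have h5 : π (closedBall x r) ≤ (partitionFunction (d := d) (L := L) ρ β)⁻¹ *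
          (ENNReal.ofReal (Real.exp (-(β * (S (T x) - ε / (β + 1))))) * π (closedBall (T x) (K * r))) :=
        h2.trans (by rw [hμW]; exact mul_le_mul' le_rfl h3)
      have h6 := ENNReal.toReal_mono hfin h5
      rw [ENNReal.toReal_mul, ENNReal.toReal_mul, ENNReal.toReal_inv, ENNReal.toReal_ofReal (Real.exp_pos _).le]
        at h6
      refine h6.trans (mul_le_mul_of_nonneg_left (mul_le_mul_of_nonneg_left h4 (Real.exp_pos _).le) ?_)
      exact inv_nonneg.2 hZpos.le
    have h7 : (a * r ^ κ) ^ nE ≤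
        Z⁻¹ * (Real.exp (-(β * (S (T x) - ε / (β + 1)))) * (A * (K * r) ^ κ) ^ nE) := h1.trans hchain
    -- logarithms
    have hlhs : 0 < (a * r ^ κ) ^ nE := by positivity
    have h8 := Real.log_le_log hlhs h7
    rw [Real.log_pow, Real.log_mul ha.ne' (pow_pos hr0 _).ne', Real.log_pow,
      Real.log_mul (inv_pos.2 hZpos).ne' (by positivity), Real.log_inv,
      Real.log_mul (Real.exp_pos _).ne' (by positivity), Real.log_exp, Real.log_pow,
      Real.log_mul hA.ne' (by positivity), Real.log_pow, Real.log_mul hK0.ne' hr0.ne'] at h8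
    rw [Real.log_div hA.ne' ha.ne']
    linarith only [h8, hβε]
  -- STEP 2: `-log Z - β S(Tx) ≤ nE (log(A/a) + κ log K')`
  have step2 : ∀ x, -Real.log Z - β * S (T x) ≤ nE * (Real.log (A / a) + κ * Real.log K') := by
    intro x
    refine le_of_forall_pos_le_add fun ε hε => ?_
    have hε' : 0 < ε / (β + 1) := by positivity
    have hβε : β * (ε / (β + 1)) ≤ ε := by
      rw [mul_div_assoc', div_le_iff₀ (by positivity)]; nlinarith
    obtain ⟨δ, hδ, hδS⟩ := Metric.continuous_iff.1 hScont (T x) (ε / (β + 1)) hε'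
    set r : ℝ := min 1 (δ / 2) with hr
    have hr0 : 0 < r := lt_min one_pos (by positivity)
    have hr1 : r ≤ 1 := min_le_left _ _
    have hrδ : r < δ := lt_of_le_of_lt (min_le_right _ _) (by linarith)
    -- (i) `μ(B̄(Tx, r)) ≤ π(B̄(x, K' r)) ≤ (A (K' r)^κ)^{nE}`
    have hsub : T ⁻¹' closedBall (T x) r ⊆ closedBall x (K' * r) := fun u hu => by
      rw [mem_preimage, mem_closedBall] at hu
      rw [mem_closedBall]
      exact (hT'.le_mul_dist u x).trans (mul_le_mul_of_nonneg_left hu K'.coe_nonneg)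
    have h2 : wilsonMeasure (d := d) (L := L) ρ β (closedBall (T x) r) ≤ π (closedBall x (K' * r)) := by
      rw [hμT _ measurableSet_closedBall]; exact measure_mono hsub
    have h4 := pi_closedBall_le_pow hup x (mul_pos hK'0 hr0)
    -- (ii) `Z⁻¹ e^{-β(S(Tx)+ε)} (a r^κ)^{nE} ≤ μ(B̄(Tx, r))`
    have hSB : ∀ U ∈ closedBall (T x) r, S U ≤ S (T x) + ε / (β + 1) := fun U hU => by
      have hd : dist U (T x) < δ := lt_of_le_of_lt (mem_closedBall.1 hU) hrδ
      have := hδS U hd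
      rw [Real.dist_eq] at this
      linarith [(abs_lt.1 this).2]
    have h3 := le_wilsonWeight_of_le ρ hβ0 measurableSet_closedBall hSB
    have h1 := pow_le_pi_closedBall ha.le hlo (T x) hr0 hr1
    have hchain : Z⁻¹ * (Real.exp (-(β * (S (T x) + ε / (β + 1)))) * (a * r ^ κ) ^ nE) ≤
        (π (closedBall x (K' * r))).toReal := by
      have h5 : (partitionFunction (d := d) (L := L) ρ β)⁻¹ *
          (ENNReal.ofReal (Real.exp (-(β * (S (T x) + ε / (β + 1))))) * π (closedBall (T x) r)) ≤
            π (closedBall x (K' * r)) :=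
        le_trans (by rw [hμW]; exact mul_le_mul' le_rfl h3) h2
      have h6 := ENNReal.toReal_mono (measure_ne_top _ _) h5
      rw [ENNReal.toReal_mul, ENNReal.toReal_mul, ENNReal.toReal_inv, ENNReal.toReal_ofReal (Real.exp_pos _).le]
        at h6
      refine le_trans (mul_le_mul_of_nonneg_left (mul_le_mul_of_nonneg_left h1 (Real.exp_pos _).le) ?_) h6
      exact inv_nonneg.2 hZpos.le
    have h7 : Z⁻¹ * (Real.exp (-(β * (S (T x) + ε / (β + 1)))) * (a * r ^ κ) ^ nE) ≤
        (A * (K' * r) ^ κ) ^ nE := hchain.trans h4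
    have hlhs : 0 < Z⁻¹ * (Real.exp (-(β * (S (T x) + ε / (β + 1)))) * (a * r ^ κ) ^ nE) := by positivity
    have h8 := Real.log_le_log hlhs h7
    rw [Real.log_mul (inv_pos.2 hZpos).ne' (by positivity), Real.log_inv,
      Real.log_mul (Real.exp_pos _).ne' (by positivity), Real.log_exp, Real.log_pow,
      Real.log_mul ha.ne' (pow_pos hr0 _).ne', Real.log_pow, Real.log_pow,
      Real.log_mul hA.ne' (by positivity), Real.log_pow, Real.log_mul hK'0.ne' hr0.ne'] at h8
    rw [Real.log_div hA.ne' ha.ne']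
    linarith only [h8, hβε]
  -- STEP 3: points of the image of `T` with large / small action
  haveI : (haarProbability G).IsHaarMeasure := Measure.isHaarMeasure_haarMeasure _
  have himage : ∀ (O : Set (GaugeConfig d L G)), IsOpen O → O.Nonempty → ∃ x, T x ∈ O := by
    intro O hO hne
    have hpos : 0 < wilsonMeasure (d := d) (L := L) ρ β O :=
      wilsonMeasure_pos_of_pi_pos ρ htr htr' hβ0 hO.measurableSet (hO.measure_pos π hne)
    rw [hμT O hO.measurableSet] at hpos
    exact nonempty_of_measure_ne_zero hpos.ne'
  obtain ⟨x₁, hx₁⟩ := himage {U | s₀ * (L : ℝ) ^ d / 2 < S U} (isOpen_lt continuous_const hScont)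
    ⟨Vhi, by show s₀ * (L : ℝ) ^ d / 2 < S Vhi; rw [hSdef]; linarith⟩
  obtain ⟨x₂, hx₂⟩ := himage {U | S U < s₀ * (L : ℝ) ^ d / 4} (isOpen_lt hScont continuous_const)
    ⟨V₁, by show S V₁ < s₀ * (L : ℝ) ^ d / 4; rw [hS1]; positivity⟩
  have hx₁' : s₀ * (L : ℝ) ^ d / 2 < S (T x₁) := hx₁
  have hx₂' : S (T x₂) < s₀ * (L : ℝ) ^ d / 4 := hx₂
  -- STEP 4: combine
  have hsum := add_le_add (step1 x₁) (step2 x₂)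
  have hlogKK : Real.log ((K : ℝ) * K') = Real.log K + Real.log K' := Real.log_mul hK0.ne' hK'0.ne'
  have key : β * (s₀ / (8 * κ * d)) ≤ Real.log ((K : ℝ) * K') := by
    rw [hlogKK]
    -- `β s₀ L^d / 4 ≤ nE (2 log(A/a) + κ (log K + log K'))`, `nE = d L^d`, `β ≥ 16 d log(A/a)/s₀`
    have hn : (nE : ℝ) = d * (L : ℝ) ^ d := by rw [hnE, hE]
    rw [hn] at hsum
    have hβ' : 16 * d * Real.log (A / a) ≤ β * s₀ := by
      have := mul_le_mul_of_nonneg_right hβ hs₀.le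
      rwa [div_mul_cancel₀ _ hs₀.ne'] at this
    have hLd0 : (0 : ℝ) < (L : ℝ) ^ d := by positivity
    have hdk : (0 : ℝ) < 8 * κ * d := by positivity
    rw [mul_div_assoc', div_le_iff₀ hdk]
    nlinarith only [hsum, hx₁', hx₂', hβ', hLd0, hκr, hdr, hlogAa, hβ0, hs₀]
  calc Real.exp (s₀ / (8 * κ * d) * β) = Real.exp (β * (s₀ / (8 * κ * d))) := by rw [mul_comm]
    _ ≤ Real.exp (Real.log ((K : ℝ) * K')) := Real.exp_le_exp.2 key
    _ = (K : ℝ) * K' := Real.exp_log (mul_pos hK0 hK'0)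


end ExactTransportR

/-! ## The instance `U(1) = Circle`, `u1Rep`, `d ≥ 2` -/

namespace U1

open Literature.MathematicalPhysics.QuantumLattice (u1Rep continuous_u1Rep)

/-- `-1 ≤ Re tr u1Rep z` (`= Re z`, `|z| = 1`). [folklore] -/
theorem neg_one_le_re_trace (z : Circle) : -((1 : ℕ) : ℝ) ≤ (u1Rep z).trace.re := by
  rw [trace_u1Rep_re, Nat.cast_one]
  have h := Complex.abs_re_le_norm (z : ℂ)
  rw [Circle.norm_coe] at h
  exact (abs_le.1 h).1

/-- **(C2a-R) for `U(1)`** (OURS; closes the `U(1)` instance of the repaired conjecture item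
`Conjectures.ExactTransportBiLipschitzR`): for `d ≥ 2` there are `c > 0`, `β₀` with `Lip(T)·coLip(T) ≥ e^{cβ}` for every
exact bi-Lipschitz transport of `Haar^{⊗E}` onto the `U(1)` Wilson measure, every `L ≥ 2`, `β ≥ β₀`. [folklore] -/
theorem exactTransportBiLipschitzR (d : ℕ) (hd : 2 ≤ d) : Conjectures.ExactTransportBiLipschitzR d 1 Circle u1Rep := by
  obtain ⟨a, ha, hlo⟩ := haar_closedBall_ge'
  obtain ⟨A, _, hup⟩ := haar_closedBall_le'
  obtain ⟨s₀, hs₀, hconf⟩ := extensive_action_R (d := d) hd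
  exact exactTransportBiLipschitzR_of_ballVolumes u1Rep d (by omega) continuous_u1Rep re_trace_u1Rep_le
    neg_one_le_re_trace one_pos ha hlo hup hs₀ fun L _ hL => hconf L hL

end U1

end Summit.Ventures.LatticeQCDFlow.Theory2.Lattice

end
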